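import Mathlib.MeasureTheory.Function.JacobianOneDim      -- `lintegral_image_eq_lintegral_abs_deriv_mul` (one radial substitution per ray)
import Literature.Geometry.ComplexHyperbolic.UnitBallKCentralBlowUp           -- ★ polar coordinates `exists_angularMeasure` (via ★ `UnitBallPolarCoordinates`), ★ `UnitBallNegativeLineProjector`
import Literature.Geometry.ComplexHyperbolic.UnitBallKCentralOrbitalIntegral  -- ★ `pencil_smul` (the pencil sees only the line)
import Literature.Geometry.ComplexHyperbolic.UnitBallFrameTorus               -- ★ `lift_proj`
import HarnessLib

/-!
# The hyperboloid chart of the ball: the Bergman volume is `9 ×` Lebesgue measure on `ℂ²`, and the `K`-central ball averages of `U(2,1)`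
# are integrals over the hyperboloid sheet `Q = −1` (ROAD A (A3-b), analytic toolkit III)

Topic `Geometry/ComplexHyperbolic`; namespace `Literature.Geometry.ComplexHyperbolic.BallModel`.  THEOREMS ONLY (no `def`, no instance, no notation,
no axiom, no named fact, no `sorry`).  Cell `pub/hodgecm-mathlib`, ENGINE T1 (crux H413 = `stmt-HodgeConjecture-24833`); floor-1½ preparation, count-neutral,
under row (S-d) ∕ «SdArch» ED. 3 node N1 = the (L_{U(2,1)}) letter ★ `ArchCentralLimitFormulaRankTwo` (`stub_ArchCentralLimitU21`): brick **ROAD A (A3-b) III**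
of the in-house road to Harish-Chandra's central limit formula on `U(2,1)` (F0P3a-p03 (g10) census c3af6e58 §2 (A3); A-p14 (g28) cost census e5e8455f §3;
LEAD F0P3a-plan (g10) WORD T9-1 (4), 2026-09-01; author F0P3a-p05 (g13)).  Continues ★ `UnitBallKCentralOrbitalIntegral` ((A3-a): the `K`-central orbital
integrals of `U(2,1)` ARE the ball averages `∫_{𝔹²} Θ(u•1 + (v−u)•P(lift z)) dβ`), ★ `UnitBallNegativeLineProjector`, ★ `UnitBallPolarCoordinates`;
consumed by ★-to-be `UnitBallKCentralConeLimit` (the blow-up `W = √ε·w`, the sheets `Q = −ε`, the leading term at the centre).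

THE MATHEMATICS.  Let `x(W, ε) := (W₀, W₁, √(ε + |W|²)) ∈ ℂ³` (`W ∈ ℂ²`, `ε ≥ 0`): the point of the hyperboloid sheet `Q = −ε` over `W`
(`Q(x) = |W|² − (ε+|W|²) = −ε`), and `N(x) := x x* J`.  (1) THE CHART.  `W ↦ proj x(W,1) = (1+|W|²)^{-1∕2}·W` is a homeomorphism `ℂ² ≃ 𝔹²`
(inverse `z ↦ (1−|z|²)^{-1∕2}·z`; the projective ∕ hyperboloid model of `H²_ℂ` read over `ℂ²`), and under it THE BERGMAN VOLUME IS EXACTLY `9 ×`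
LEBESGUE MEASURE: `β = 9 · chart_* vol_{ℂ²}` — the real Jacobian of `W ↦ (1+|W|²)^{-1∕2}W` on `ℝ⁴` is `(1+|W|²)⁻³` while `9(1−|z|²)⁻³ = 9(1+|W|²)³`.
We prove it WITHOUT a `4 × 4` Jacobian: polar coordinates (★ `exists_angularMeasure`) on both sides reduce it to ONE monotone substitution `r = t∕√(1+t²)`
per ray (`r³·9(1−r²)⁻³ dr = 9 t³ dt`, Mathlib's one-variable change of variables).  (2) THE PENCIL.  `lift (proj x) = x₂⁻¹ • x` (★ `lift_proj`) and the
pencil sees only the line (★ `pencil_smul`), so `P(lift(chart W)) = Q(x)⁻¹ N(x) = −N(W, √(1+|W|²))`; hence for EVERY `Θ : M₃(ℂ) → G` and `u, c ∈ ℂ`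
(no hypothesis on `Θ`: both sides vanish together when not integrable)
  **`∫_{𝔹²} Θ(u•1 + c•P(lift z)) dβ(z) = 9 ∫_{ℂ²} Θ(u•1 − c•N(W, √(1+|W|²))) d⁴W`**
— the conjugation class of the `K`-central element `diag(u,u,u+c) ∈ U(2,1)` (★ `mat_conj_kCentral_eq`) read over the sheet `Q = −1` with LEBESGUE measure.
WHY THIS CHART (for the successor bricks (A3-c)∕(A4) of ROAD A): after the blow-up `W ↦ √ε·W` the sheets `Q = −ε` degenerate to the null cone `{(W,|W|)}`
INSIDE ONE GLOBAL CHART with a FIXED measure `9 d⁴W`; `∂_ε √(ε+|W|²) = 1∕(2√(ε+|W|²))` and `∂_ε² = −1∕(4(ε+|W|²)^{3∕2})` are dominated by `|W|⁻¹`, `|W|⁻³`,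
both integrable near `0 ∈ ℝ⁴`, so the expansion of the `ε²`-normalised orbital integrals at the centre is «differentiate under the integral sign» — no
ray-by-ray endpoint analysis (the ray form ★ `sq_smul_integral_bergmanVolume_pencil_eq` carries an `ε² log ε` per ray that only cancels after `dσ`).

* §1 the sheets `Q = −ε` (`Q_vecCons_sqrt`, the `(2,2)` entry of `N`), the chart `proj x(W,1) = (1+|W|²)^{-1∕2}W` and its inverse, continuity, surjectivity,
  **`measurableEmbedding_chart`**;
* §2 the radial substitution `t ↦ t∕√(1+t²) : (0,∞) ≃ (0,1)` (derivative `(1+t²)^{-3∕2}`, two-sided inverse, image, injectivity);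
* §3 `lintegral_ray_bergman_indicator` (per ray), **`bergmanVolume_eq_smul_map_chart : β = 9 • vol.map chart`**, `lintegral_∕integral_bergmanVolume_eq_chart`
  (ANY integrand, via `MeasurableEmbedding.integral_map`), `integrable_bergmanVolume_iff_chart`;
* §4 **`pencil_lift_chart`**, **`integral_bergmanVolume_pencil_eq_chart`** (the displayed identity).
HONEST LABEL: HC_CM is proved only modulo the printed citations until rung 0 closes; this file is real analysis over ★ ball-model files and pays nothing by itself.

## References
* [Rogawski1990] J. D. Rogawski, *Automorphic Representations of Unitary Groups in Three Variables*, Ann. of Math. Stud. 123 (1990), §8.4 pp. 126–127 (normalisation of the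
  singular orbital integrals at the compact wall of `U(2,1)`; the central limit formula).
* [Goldman1999] W. M. Goldman, *Complex Hyperbolic Geometry* (1999), §3.1.1–3.1.2 (projective and hyperboloid models of `H²_ℂ`, negative lines and their projectors).
* [Rudin1980] W. Rudin, *Function Theory in the Unit Ball of ℂⁿ* (1980), §1.4 (polar coordinates), §2.2 (the invariant measure `(1−|z|²)^{−(n+1)}dν`).
* [Helgason2000] S. Helgason, *Groups and Geometric Analysis* (2000), Ch. I §1 No. 2 (invariant integration on `G∕K`).
* [Jacobowitz1990] H. Jacobowitz, *An Introduction to CR Structures* (1990), Ch. 2 §1 (the ball model of `SU(2,1)`).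
-/

noncomputable section

open MeasureTheory MeasureTheory.Measure Set Matrix Complex ComplexConjugate Filter Topology
open scoped ENNReal

namespace Literature.Geometry.ComplexHyperbolic.BallModel

/-! ### §1 The hyperboloid sheets `Q = −ε` over `ℂ²` and the chart `W ↦ proj (W, √(1+|W|²)) : ℂ² → 𝔹²` -/

/-- The point `(W₀, W₁, √(ε + |W|²))` lies on the sheet `Q = −ε` (`ε + |W|² ≥ 0`). [cite: Goldman1999, §3.1.1] -/
theorem Q_vecCons_sqrt (ε : ℝ) (W : Fin 2 → ℂ) (h : 0 ≤ ε + nsq W) :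
    Q ![W 0, W 1, (Real.sqrt (ε + nsq W) : ℂ)] = -ε := by
  have hs : ‖((Real.sqrt (ε + nsq W) : ℝ) : ℂ)‖ ^ 2 = ε + nsq W := by
    rw [Complex.norm_real, Real.norm_eq_abs, sq_abs, Real.sq_sqrt h]
  simp only [Q, cons_val_zero, cons_val_one, cons_val, hs]
  unfold nsq
  ring

/-- The `(2,2)` entry of `N(W₀, W₁, √(ε+|W|²)) = x x* J` is `−(ε + |W|²)` (`ε + |W|² ≥ 0`). [cite: Goldman1999, §3.1.1] -/
theorem vecMulVec_vecCons_sqrt_mul_J_apply_two_two (ε : ℝ) (W : Fin 2 → ℂ) (h : 0 ≤ ε + nsq W) :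
    (vecMulVec ![W 0, W 1, (Real.sqrt (ε + nsq W) : ℂ)] (star ![W 0, W 1, (Real.sqrt (ε + nsq W) : ℂ)]) * J) 2 2 = -(((ε + nsq W : ℝ)) : ℂ) := by
  rw [vecMulVec_star_mul_J_apply]
  simp only [cons_val, J, diagonal_apply_eq, Complex.conj_ofReal, mul_neg, mul_one]
  rw [← Complex.ofReal_mul, Real.mul_self_sqrt h]

/-- At `ε = 1`: `Q(W, √(1+|W|²)) < 0`, so the sheet `Q = −1` projects to the ball. [cite: Goldman1999, §3.1.1] -/
theorem Q_vecCons_sqrt_one_add_nsq_neg (W : Fin 2 → ℂ) : Q ![W 0, W 1, (Real.sqrt (1 + nsq W) : ℂ)] < 0 := by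
  rw [Q_vecCons_sqrt 1 W (by linarith [nsq_nonneg W])]
  norm_num

/-- **THE HYPERBOLOID CHART READ IN `ℂ²`**: `proj (W, √(1+|W|²)) = (1+|W|²)^{-1∕2} · W`. [cite: Goldman1999, §3.1.1] [cite: Rudin1980, §2.2] -/
theorem coe_proj_vecCons_sqrt (W : Fin 2 → ℂ) :
    (proj ![W 0, W 1, (Real.sqrt (1 + nsq W) : ℂ)] (Q_vecCons_sqrt_one_add_nsq_neg W)).1 = (Real.sqrt (1 + nsq W))⁻¹ • W := by
  funext i
  fin_cases i
  · simp only [proj, cons_val_zero, cons_val, Fin.zero_eta, Pi.smul_apply, Complex.real_smul, Complex.ofReal_inv, div_eq_inv_mul]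
  · simp only [proj, cons_val_one, cons_val, Fin.mk_one, Pi.smul_apply, Complex.real_smul, Complex.ofReal_inv, div_eq_inv_mul]

/-- `|(1+|W|²)^{-1∕2} W|² = |W|² ∕ (1 + |W|²)`. [cite: Rudin1980, §2.2] [cite: Goldman1999, §3.1.1] -/
theorem nsq_inv_sqrt_one_add_nsq_smul (W : Fin 2 → ℂ) :
    nsq ((Real.sqrt (1 + nsq W))⁻¹ • W) = nsq W / (1 + nsq W) := by
  have hpos : 0 < 1 + nsq W := by linarith [nsq_nonneg W]
  rw [nsq_real_smul, inv_pow, Real.sq_sqrt hpos.le, div_eq_inv_mul]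

/-- `1 − |chart W|² = (1 + |W|²)⁻¹`: the chart inverts the conformal factor. [cite: Rudin1980, §2.2] [cite: Goldman1999, §3.1.1] -/
theorem one_sub_nsq_inv_sqrt_one_add_nsq_smul (W : Fin 2 → ℂ) : 1 - nsq ((Real.sqrt (1 + nsq W))⁻¹ • W) = (1 + nsq W)⁻¹ := by
  have hpos : 0 < 1 + nsq W := by linarith [nsq_nonneg W]
  rw [nsq_inv_sqrt_one_add_nsq_smul]
  field_simp
  ring

/-- LEFT INVERSE: `z ↦ (1 − |z|²)^{-1∕2} z` at `z = (1+|W|²)^{-1∕2} W` gives back `W`. [cite: Rudin1980, §2.2] [cite: Goldman1999, §3.1.1] -/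
theorem inv_sqrt_one_sub_nsq_smul_inv_sqrt_one_add_nsq_smul (W : Fin 2 → ℂ) :
    (Real.sqrt (1 - nsq ((Real.sqrt (1 + nsq W))⁻¹ • W)))⁻¹ • ((Real.sqrt (1 + nsq W))⁻¹ • W) = W := by
  have hpos : 0 < 1 + nsq W := by linarith [nsq_nonneg W]
  rw [one_sub_nsq_inv_sqrt_one_add_nsq_smul, Real.sqrt_inv, inv_inv, smul_smul, mul_inv_cancel₀ (Real.sqrt_pos.2 hpos).ne', one_smul]

/-- `|(1−|z|²)^{-1∕2} z|² = |z|² ∕ (1 − |z|²)` on the ball. [cite: Rudin1980, §2.2] [cite: Goldman1999, §3.1.1] -/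
theorem nsq_inv_sqrt_one_sub_nsq_smul (z : Ball) : nsq ((Real.sqrt (1 - nsq z.1))⁻¹ • z.1) = nsq z.1 / (1 - nsq z.1) := by
  have hpos : 0 < 1 - nsq z.1 := sub_pos.2 z.2
  rw [nsq_real_smul, inv_pow, Real.sq_sqrt hpos.le, div_eq_inv_mul]

/-- `1 + |(1−|z|²)^{-1∕2} z|² = (1 − |z|²)⁻¹` on the ball. [cite: Rudin1980, §2.2] [cite: Goldman1999, §3.1.1] -/
theorem one_add_nsq_inv_sqrt_one_sub_nsq_smul (z : Ball) : 1 + nsq ((Real.sqrt (1 - nsq z.1))⁻¹ • z.1) = (1 - nsq z.1)⁻¹ := by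
  have hpos : 0 < 1 - nsq z.1 := sub_pos.2 z.2
  rw [nsq_inv_sqrt_one_sub_nsq_smul]
  field_simp
  ring

/-- RIGHT INVERSE (read in `ℂ²`): the chart at `(1 − |z|²)^{-1∕2} z` gives back `z`. [cite: Rudin1980, §2.2] [cite: Goldman1999, §3.1.1] -/
theorem inv_sqrt_one_add_nsq_smul_inv_sqrt_one_sub_nsq_smul (z : Ball) :
    (Real.sqrt (1 + nsq ((Real.sqrt (1 - nsq z.1))⁻¹ • z.1)))⁻¹ • ((Real.sqrt (1 - nsq z.1))⁻¹ • z.1) = z.1 := by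
  have hpos : 0 < 1 - nsq z.1 := sub_pos.2 z.2
  rw [one_add_nsq_inv_sqrt_one_sub_nsq_smul, Real.sqrt_inv, inv_inv, smul_smul, mul_inv_cancel₀ (Real.sqrt_pos.2 hpos).ne', one_smul]

/-- LEFT INVERSE for the chart itself: `(1 − |chart W|²)^{-1∕2} · chart W = W`. [cite: Rudin1980, §2.2] -/
theorem unchart_chart (W : Fin 2 → ℂ) :
    (Real.sqrt (1 - nsq (proj ![W 0, W 1, (Real.sqrt (1 + nsq W) : ℂ)] (Q_vecCons_sqrt_one_add_nsq_neg W)).1))⁻¹ •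
      (proj ![W 0, W 1, (Real.sqrt (1 + nsq W) : ℂ)] (Q_vecCons_sqrt_one_add_nsq_neg W)).1 = W := by
  rw [coe_proj_vecCons_sqrt, inv_sqrt_one_sub_nsq_smul_inv_sqrt_one_add_nsq_smul]

/-- RIGHT INVERSE for the chart itself: `chart ((1 − |z|²)^{-1∕2} z) = z`. [cite: Rudin1980, §2.2] -/
theorem chart_unchart (z : Ball) :
    proj ![((Real.sqrt (1 - nsq z.1))⁻¹ • z.1) 0, ((Real.sqrt (1 - nsq z.1))⁻¹ • z.1) 1,
        (Real.sqrt (1 + nsq ((Real.sqrt (1 - nsq z.1))⁻¹ • z.1)) : ℂ)]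
      (Q_vecCons_sqrt_one_add_nsq_neg ((Real.sqrt (1 - nsq z.1))⁻¹ • z.1)) = z :=
  Subtype.ext ((coe_proj_vecCons_sqrt _).trans (inv_sqrt_one_add_nsq_smul_inv_sqrt_one_sub_nsq_smul z))

/-- The chart `ℂ² → 𝔹²` is continuous. [cite: Rudin1980, §2.2] -/
theorem continuous_chart :
    Continuous fun W : Fin 2 → ℂ => proj ![W 0, W 1, (Real.sqrt (1 + nsq W) : ℂ)] (Q_vecCons_sqrt_one_add_nsq_neg W) := by
  have h : ∀ W : Fin 2 → ℂ, Real.sqrt (1 + nsq W) ≠ 0 := fun W => (Real.sqrt_pos.2 (by linarith [nsq_nonneg W])).ne'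
  have hc : Continuous fun W : Fin 2 → ℂ => (Real.sqrt (1 + nsq W))⁻¹ • W :=
    ((continuous_const.add continuous_fun_nsq).sqrt.inv₀ fun W => h W).smul continuous_id
  refine continuous_induced_rng.2 ?_
  exact hc.congr fun W => (coe_proj_vecCons_sqrt W).symm

/-- The inverse chart `𝔹² → ℂ²`, `z ↦ (1 − |z|²)^{-1∕2} z`, is continuous. [cite: Rudin1980, §2.2] -/
theorem continuous_unchart : Continuous fun z : Ball => (Real.sqrt (1 - nsq z.1))⁻¹ • z.1 := by
  have hn : Continuous fun z : Ball => nsq z.1 := continuous_fun_nsq.comp continuous_subtype_val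
  refine ((continuous_const.sub hn).sqrt.inv₀ fun z => ?_).smul continuous_subtype_val
  exact (Real.sqrt_pos.2 (sub_pos.2 z.2)).ne'

/-- The chart is onto the ball. [cite: Rudin1980, §2.2] -/
theorem range_chart :
    range (fun W : Fin 2 → ℂ => proj ![W 0, W 1, (Real.sqrt (1 + nsq W) : ℂ)] (Q_vecCons_sqrt_one_add_nsq_neg W)) = univ :=
  range_eq_univ.2 fun z => ⟨(Real.sqrt (1 - nsq z.1))⁻¹ • z.1, chart_unchart z⟩

/-- **The chart `ℂ² → 𝔹²` is a measurable embedding** (a homeomorphism, in fact), so every integral over the ball pulls back along it with no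
measurability hypothesis on the integrand. [cite: Rudin1980, §2.2] -/
theorem measurableEmbedding_chart :
    MeasurableEmbedding fun W : Fin 2 → ℂ => proj ![W 0, W 1, (Real.sqrt (1 + nsq W) : ℂ)] (Q_vecCons_sqrt_one_add_nsq_neg W) := by
  refine MeasurableEmbedding.of_measurable_inverse continuous_chart.measurable ?_ continuous_unchart.measurable fun W => ?_
  · rw [range_chart]; exact MeasurableSet.univ
  · exact unchart_chart W

/-! ### §2 The radial substitution `r = t ∕ √(1+t²)` -/

/-- The ray map `t ↦ t∕√(1+t²)` has derivative `(1+t²)^{-3∕2}`. [cite: Rudin1980, §1.4] -/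
theorem hasDerivAt_ray (t : ℝ) : HasDerivAt (fun t : ℝ => (Real.sqrt (1 + t ^ 2))⁻¹ * t) ((Real.sqrt (1 + t ^ 2))⁻¹ ^ 3) t := by
  have hpos : 0 < 1 + t ^ 2 := by positivity
  set s := Real.sqrt (1 + t ^ 2) with hs
  have hs0 : 0 < s := Real.sqrt_pos.2 hpos
  have hs2 : s ^ 2 = 1 + t ^ 2 := Real.sq_sqrt hpos.le
  have h1 : HasDerivAt (fun t : ℝ => 1 + t ^ 2) (2 * t) t := by
    simpa using (hasDerivAt_pow 2 t).const_add 1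
  have h2 : HasDerivAt (fun t : ℝ => Real.sqrt (1 + t ^ 2)) (2 * t / (2 * s)) t := h1.sqrt hpos.ne'
  have h3 : HasDerivAt (fun t : ℝ => (Real.sqrt (1 + t ^ 2))⁻¹) (-(2 * t / (2 * s)) / s ^ 2) t := h2.inv hs0.ne'
  have h4 := h3.mul (hasDerivAt_id t)
  refine h4.congr_deriv ?_
  simp only [id_eq, ← hs]
  field_simp
  nlinarith [hs2]

/-- The ray map is inverted by `r ↦ r∕√(1−r²)` (left inverse, all `t`). [cite: Rudin1980, §1.4] -/
theorem inv_sqrt_mul_ray (t : ℝ) :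
    (Real.sqrt (1 - ((Real.sqrt (1 + t ^ 2))⁻¹ * t) ^ 2))⁻¹ * ((Real.sqrt (1 + t ^ 2))⁻¹ * t) = t := by
  have hpos : 0 < 1 + t ^ 2 := by positivity
  have h1 : 1 - ((Real.sqrt (1 + t ^ 2))⁻¹ * t) ^ 2 = (1 + t ^ 2)⁻¹ := by
    rw [mul_pow, inv_pow, Real.sq_sqrt hpos.le]
    field_simp
    ring
  rw [h1, Real.sqrt_inv, inv_inv, ← mul_assoc, mul_inv_cancel₀ (Real.sqrt_pos.2 hpos).ne', one_mul]

/-- … and right inverse on `r² < 1`. [cite: Rudin1980, §1.4] -/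
theorem ray_inv_sqrt_mul (r : ℝ) (hr : r ^ 2 < 1) :
    (Real.sqrt (1 + ((Real.sqrt (1 - r ^ 2))⁻¹ * r) ^ 2))⁻¹ * ((Real.sqrt (1 - r ^ 2))⁻¹ * r) = r := by
  have hpos : 0 < 1 - r ^ 2 := by linarith
  have h1 : 1 + ((Real.sqrt (1 - r ^ 2))⁻¹ * r) ^ 2 = (1 - r ^ 2)⁻¹ := by
    rw [mul_pow, inv_pow, Real.sq_sqrt hpos.le]
    field_simp
    ring
  rw [h1, Real.sqrt_inv, inv_inv, ← mul_assoc, mul_inv_cancel₀ (Real.sqrt_pos.2 hpos).ne', one_mul]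

/-- The ray map sends `(0, ∞)` onto `(0, 1)`. [cite: Rudin1980, §1.4] -/
theorem image_ray_Ioi : (fun t : ℝ => (Real.sqrt (1 + t ^ 2))⁻¹ * t) '' Ioi 0 = Ioo 0 1 := by
  ext r
  constructor
  · rintro ⟨t, ht, rfl⟩
    have ht0 : 0 < t := ht
    have hpos : 0 < 1 + t ^ 2 := by positivity
    have hs0 : 0 < Real.sqrt (1 + t ^ 2) := Real.sqrt_pos.2 hpos
    refine ⟨by positivity, ?_⟩
    rw [inv_mul_lt_iff₀ hs0, mul_one, Real.lt_sqrt ht0.le]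
    linarith
  · rintro ⟨hr0, hr1⟩
    have hr2 : r ^ 2 < 1 := by nlinarith
    have hpos : 0 < 1 - r ^ 2 := by linarith
    exact ⟨(Real.sqrt (1 - r ^ 2))⁻¹ * r, mul_pos (inv_pos.2 (Real.sqrt_pos.2 hpos)) hr0, ray_inv_sqrt_mul r hr2⟩

/-- The ray map is injective on `(0, ∞)`. [cite: Rudin1980, §1.4] -/
theorem injOn_ray_Ioi : InjOn (fun t : ℝ => (Real.sqrt (1 + t ^ 2))⁻¹ * t) (Ioi 0) := by
  intro a _ b _ hab
  have h := congrArg (fun r : ℝ => (Real.sqrt (1 - r ^ 2))⁻¹ * r) hab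
  simp only at h
  rwa [inv_sqrt_mul_ray a, inv_sqrt_mul_ray b] at h

/-! ### §3 The Bergman volume in the chart: `dβ = 9 · d⁴W` -/

/-- PER RAY (`|ω|² = 1`): the radial substitution `r = t∕√(1+t²)` turns the Bergman-weighted radial integral of the indicator of `S ⊆ 𝔹²`
(read in `ℂ²`) into `9 ×` the plain `t³ dt` integral of the indicator of `chart⁻¹ S`:
`∫_{0<r<1} r³·9(1−r²)⁻³·𝟙_S(rω) dr = 9 ∫_{t>0} t³·𝟙_S(chart(tω)) dt`. [cite: Rudin1980, §1.4, §2.2] -/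
theorem lintegral_ray_bergman_indicator (S : Set Ball) {ω : Fin 2 → ℂ} (hω : nsq ω = 1) :
    ∫⁻ r in Ioo (0 : ℝ) 1, ENNReal.ofReal (r ^ 3) *
        ((fun z : Ball => (z.1 : Fin 2 → ℂ)) '' S).indicator (fun w => ENNReal.ofReal (9 * ((1 - nsq w)⁻¹) ^ 3)) (r • ω) =
      9 * ∫⁻ t in Ioi (0 : ℝ), ENNReal.ofReal (t ^ 3) *
        ((fun W : Fin 2 → ℂ => proj ![W 0, W 1, (Real.sqrt (1 + nsq W) : ℂ)] (Q_vecCons_sqrt_one_add_nsq_neg W)) ⁻¹' S).indicator 1 (t • ω) := by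
  rw [← image_ray_Ioi, lintegral_image_eq_lintegral_abs_deriv_mul measurableSet_Ioi (fun t _ => (hasDerivAt_ray t).hasDerivWithinAt) injOn_ray_Ioi,
    ← lintegral_const_mul' _ _ ENNReal.ofNat_ne_top]
  refine setLIntegral_congr_fun measurableSet_Ioi fun t ht => ?_
  have ht0 : 0 < t := ht
  have hpos : 0 < 1 + t ^ 2 := by positivity
  set s := Real.sqrt (1 + t ^ 2) with hs
  have hs0 : 0 < s := Real.sqrt_pos.2 hpos
  have hsne : s ≠ 0 := hs0.ne'
  have hs2 : s ^ 2 = 1 + t ^ 2 := Real.sq_sqrt hpos.le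
  have hnsq : nsq (t • ω) = t ^ 2 := by rw [nsq_real_smul, hω, mul_one]
  have hchart : (proj ![(t • ω) 0, (t • ω) 1, (Real.sqrt (1 + nsq (t • ω)) : ℂ)] (Q_vecCons_sqrt_one_add_nsq_neg (t • ω))).1 = (s⁻¹ * t) • ω := by
    rw [coe_proj_vecCons_sqrt, hnsq, smul_smul]
  have hnsq' : nsq ((s⁻¹ * t) • ω) = (s⁻¹ * t) ^ 2 := by rw [nsq_real_smul, hω, mul_one]
  by_cases hmem : proj ![(t • ω) 0, (t • ω) 1, (Real.sqrt (1 + nsq (t • ω)) : ℂ)] (Q_vecCons_sqrt_one_add_nsq_neg (t • ω)) ∈ S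
  · have hmem' : (s⁻¹ * t) • ω ∈ (fun z : Ball => (z.1 : Fin 2 → ℂ)) '' S := ⟨_, hmem, hchart⟩
    have hpre : t • ω ∈ (fun W : Fin 2 → ℂ => proj ![W 0, W 1, (Real.sqrt (1 + nsq W) : ℂ)] (Q_vecCons_sqrt_one_add_nsq_neg W)) ⁻¹' S := hmem
    rw [indicator_of_mem hmem', indicator_of_mem hpre, Pi.one_apply, mul_one, hnsq', abs_of_pos (by positivity : 0 < s⁻¹ ^ 3),
      ← ENNReal.ofReal_mul (by positivity : (0 : ℝ) ≤ (s⁻¹ * t) ^ 3), ← ENNReal.ofReal_mul (by positivity : (0 : ℝ) ≤ s⁻¹ ^ 3),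
      ← ENNReal.ofReal_ofNat 9, ← ENNReal.ofReal_mul (by norm_num : (0 : ℝ) ≤ 9)]
    congr 1
    have h1 : 1 - (s⁻¹ * t) ^ 2 = (s ^ 2)⁻¹ := by
      rw [mul_pow, inv_pow, hs2]
      field_simp
      ring
    rw [h1, inv_inv]
    field_simp
  · have hmem' : (s⁻¹ * t) • ω ∉ (fun z : Ball => (z.1 : Fin 2 → ℂ)) '' S := by
      rintro ⟨y, hy, hyeq⟩
      apply hmem
      have hy' : y = proj ![(t • ω) 0, (t • ω) 1, (Real.sqrt (1 + nsq (t • ω)) : ℂ)] (Q_vecCons_sqrt_one_add_nsq_neg (t • ω)) :=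
        Subtype.ext (hyeq.trans hchart.symm)
      rwa [← hy']
    have hpre : t • ω ∉ (fun W : Fin 2 → ℂ => proj ![W 0, W 1, (Real.sqrt (1 + nsq W) : ℂ)] (Q_vecCons_sqrt_one_add_nsq_neg W)) ⁻¹' S := hmem
    simp only [indicator_of_notMem hmem', indicator_of_notMem hpre, mul_zero]

/-- **THE BERGMAN VOLUME IS `9 ×` LEBESGUE MEASURE IN THE HYPERBOLOID CHART**: `β = 9 · chart_* vol_{ℂ²}` for the chart
`W ↦ proj (W, √(1+|W|²)) = (1+|W|²)^{-1∕2} W` (the hyperboloid model of `H²_ℂ` read over `ℂ²`: `d⁴z = (1+|W|²)⁻³ d⁴W` and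
`(1−|z|²)⁻³ = (1+|W|²)³` cancel exactly).  Proof: polar coordinates ★ `exists_angularMeasure` on both sides and ★ `lintegral_ray_bergman_indicator`
on each ray. [cite: Rudin1980, §1.4, §2.2] [cite: Goldman1999, §3.1.1] [cite: Helgason2000, Ch. I §1 No. 2] -/
theorem bergmanVolume_eq_smul_map_chart :
    bergmanVolume = (9 : ℝ≥0∞) • (volume : Measure (Fin 2 → ℂ)).map
      (fun W : Fin 2 → ℂ => proj ![W 0, W 1, (Real.sqrt (1 + nsq W) : ℂ)] (Q_vecCons_sqrt_one_add_nsq_neg W)) := by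
  obtain ⟨σ, hfin, hσ1, -, hσ⟩ := exists_angularMeasure
  have hcm : Measurable fun W : Fin 2 → ℂ => proj ![W 0, W 1, (Real.sqrt (1 + nsq W) : ℂ)] (Q_vecCons_sqrt_one_add_nsq_neg W) :=
    continuous_chart.measurable
  ext S hS
  -- the ambient integrand on the left
  set F : (Fin 2 → ℂ) → ℝ≥0∞ := ((fun z : Ball => (z.1 : Fin 2 → ℂ)) '' S).indicator fun w => ENNReal.ofReal (9 * ((1 - nsq w)⁻¹) ^ 3) with hF
  have hFm : Measurable F :=
    (measurable_const.mul ((measurable_const.sub continuous_fun_nsq.measurable).inv.pow_const 3)).ennreal_ofReal.indicator (measurableSet_image_coe hS)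
  have hL : bergmanVolume S = ∫⁻ z, F z.1 ∂ballVolume := by
    rw [bergmanVolume, withDensity_apply _ hS, ← lintegral_indicator hS]
    refine lintegral_congr fun z => ?_
    by_cases hz : z ∈ S
    · rw [indicator_of_mem hz, hF, indicator_of_mem (mem_image_of_mem _ hz)]
      rfl
    · rw [indicator_of_notMem hz, hF, indicator_of_notMem]
      rintro ⟨y, hy, hyz⟩
      exact hz (Subtype.ext hyz ▸ hy)
  have hR : ((9 : ℝ≥0∞) • (volume : Measure (Fin 2 → ℂ)).map
      (fun W : Fin 2 → ℂ => proj ![W 0, W 1, (Real.sqrt (1 + nsq W) : ℂ)] (Q_vecCons_sqrt_one_add_nsq_neg W))) S =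
      9 * ∫⁻ w, ((fun W : Fin 2 → ℂ => proj ![W 0, W 1, (Real.sqrt (1 + nsq W) : ℂ)] (Q_vecCons_sqrt_one_add_nsq_neg W)) ⁻¹' S).indicator 1 w := by
    rw [Measure.smul_apply, smul_eq_mul, map_apply hcm hS, lintegral_indicator_one (hcm hS)]
  rw [hL, hR, lintegral_ballVolume_eq_lintegral_polar hσ hσ1 F hFm, lintegral_eq_lintegral_polar hσ _ (measurable_one.indicator (hcm hS)),
    ← lintegral_const_mul' _ _ ENNReal.ofNat_ne_top]
  exact lintegral_congr_ae (hσ1.mono fun ω hω => lintegral_ray_bergman_indicator S hω)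

/-- **LOWER INTEGRALS OVER THE BALL IN THE CHART**: `∫⁻_{𝔹²} f dβ = 9 ∫⁻_{ℂ²} f(chart W) d⁴W`, any `f`. [cite: Rudin1980, §2.2] -/
theorem lintegral_bergmanVolume_eq_chart (f : Ball → ℝ≥0∞) :
    ∫⁻ z, f z ∂bergmanVolume = 9 * ∫⁻ W : Fin 2 → ℂ, f (proj ![W 0, W 1, (Real.sqrt (1 + nsq W) : ℂ)] (Q_vecCons_sqrt_one_add_nsq_neg W)) := by
  rw [bergmanVolume_eq_smul_map_chart, lintegral_smul_measure, measurableEmbedding_chart.lintegral_map, smul_eq_mul]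

/-- **INTEGRALS OVER THE BALL IN THE CHART**: `∫_{𝔹²} f dβ = 9 ∫_{ℂ²} f(chart W) d⁴W` for ANY `f` (no integrability hypothesis: both sides vanish
together when `f` is not integrable). [cite: Rudin1980, §2.2] [cite: Goldman1999, §3.1.1] -/
theorem integral_bergmanVolume_eq_chart {G : Type*} [NormedAddCommGroup G] [NormedSpace ℝ G] (f : Ball → G) :
    ∫ z, f z ∂bergmanVolume = (9 : ℝ) • ∫ W : Fin 2 → ℂ, f (proj ![W 0, W 1, (Real.sqrt (1 + nsq W) : ℂ)] (Q_vecCons_sqrt_one_add_nsq_neg W)) := by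
  rw [bergmanVolume_eq_smul_map_chart, integral_smul_measure, measurableEmbedding_chart.integral_map]
  norm_num

/-- Integrability transfers along the chart: `f ∈ L¹(β) ↔ f ∘ chart ∈ L¹(ℂ²)`. [cite: Rudin1980, §2.2] -/
theorem integrable_bergmanVolume_iff_chart {G : Type*} [NormedAddCommGroup G] (f : Ball → G) :
    Integrable f bergmanVolume ↔ Integrable fun W : Fin 2 → ℂ => f (proj ![W 0, W 1, (Real.sqrt (1 + nsq W) : ℂ)] (Q_vecCons_sqrt_one_add_nsq_neg W)) := by
  rw [bergmanVolume_eq_smul_map_chart, integrable_smul_measure (by norm_num) ENNReal.ofNat_ne_top, measurableEmbedding_chart.integrable_map_iff]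
  rfl

/-! ### §4 The pencil and the `K`-central ball averages in the chart -/

/-- **THE PENCIL IN THE CHART**: `P(lift(chart W)) = −N(W, √(1+|W|²))`, `N(x) = x x* J` — the rank-one idempotent onto the negative line through
the hyperboloid point `x = (W, √(1+|W|²))` of the sheet `Q = −1` (★ `lift_proj`, ★ `pencil_smul`). [cite: Goldman1999, §3.1.1] [cite: Jacobowitz1990, Ch. 2 §1] -/
theorem pencil_lift_chart (W : Fin 2 → ℂ) :
    (((Q (lift (proj ![W 0, W 1, (Real.sqrt (1 + nsq W) : ℂ)] (Q_vecCons_sqrt_one_add_nsq_neg W))) : ℝ) : ℂ))⁻¹ •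
        (vecMulVec (lift (proj ![W 0, W 1, (Real.sqrt (1 + nsq W) : ℂ)] (Q_vecCons_sqrt_one_add_nsq_neg W)))
          (star (lift (proj ![W 0, W 1, (Real.sqrt (1 + nsq W) : ℂ)] (Q_vecCons_sqrt_one_add_nsq_neg W)))) * J) =
      -(vecMulVec ![W 0, W 1, (Real.sqrt (1 + nsq W) : ℂ)] (star ![W 0, W 1, (Real.sqrt (1 + nsq W) : ℂ)]) * J) := by
  have hs : ((Real.sqrt (1 + nsq W) : ℝ) : ℂ) ≠ 0 := by exact_mod_cast (Real.sqrt_pos.2 (by linarith [nsq_nonneg W])).ne'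
  have h2 : (![W 0, W 1, (Real.sqrt (1 + nsq W) : ℂ)] : Fin 3 → ℂ) 2 ≠ 0 := hs
  rw [lift_proj, pencil_smul _ (inv_ne_zero h2), Q_vecCons_sqrt 1 W (by linarith [nsq_nonneg W])]
  push_cast
  rw [inv_neg, inv_one, neg_one_smul]

/-- **`K`-CENTRAL BALL AVERAGES IN THE CHART** (every `Θ`, `u c ∈ ℂ`; no hypothesis):
`∫_{𝔹²} Θ(u•1 + c•P(lift z)) dβ(z) = 9 ∫_{ℂ²} Θ(u•1 − c•N(W, √(1+|W|²))) d⁴W` — the conjugation class of `diag(u,u,u+c)` in `U(2,1)` read over the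
hyperboloid sheet `Q = −1` (★ `mat_conj_kCentral_eq`, ★ `integral_comp_conj_kCentral_eq_integral_map_orbit`). [cite: Rogawski1990, §8.4 pp. 126–127] [cite: Goldman1999, §3.1.1] -/
theorem integral_bergmanVolume_pencil_eq_chart {G : Type*} [NormedAddCommGroup G] [NormedSpace ℝ G] (Θ : Matrix (Fin 3) (Fin 3) ℂ → G) (u c : ℂ) :
    ∫ z, Θ (u • (1 : Matrix (Fin 3) (Fin 3) ℂ) + c • ((((Q (lift z) : ℝ) : ℂ))⁻¹ • (vecMulVec (lift z) (star (lift z)) * J))) ∂bergmanVolume =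
      (9 : ℝ) • ∫ W : Fin 2 → ℂ, Θ (u • (1 : Matrix (Fin 3) (Fin 3) ℂ) -
        c • (vecMulVec ![W 0, W 1, (Real.sqrt (1 + nsq W) : ℂ)] (star ![W 0, W 1, (Real.sqrt (1 + nsq W) : ℂ)]) * J)) := by
  rw [integral_bergmanVolume_eq_chart]
  congr 1
  refine integral_congr_ae (Filter.Eventually.of_forall fun W => ?_)
  simp only [pencil_lift_chart, smul_neg, sub_eq_add_neg]

end Literature.Geometry.ComplexHyperbolic.BallModel

end
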